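import Mathlib
import Summits.NavierStokesRegularity.NavierStokesRegularity.Theorems.EulerZoomLiouvillePowerGaugeEulerLiouvilleCondenserGradientRiccati

/-!
# THEOREM L — THE LOGISTIC LAWS OF THE INFLOW RATIO (nsreg-p2 g34 ROUND-44 §1, plate t46-L: (L1), (L1′), (L2))

Width piece for crux `EulerZoomLiouville.PowerGaugeEulerLiouville` (stmt-NavierStokesRegularity-19832), by name under LEAD 19832
(ns-typeII-p2 g13); seat ns-ezl-w2 g4, `--supports stmt-NavierStokesRegularity-19832 --as helper`.  Texts = nsreg-p2's Sketch44 Props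
`NsregP2.R44.LogisticLawDirectional`, `…SheathIdentity`, `…LogisticLawRadial` binder-for-binder (`E3` spelled out).

For a self-similar Euler profile `(U, P)` (CIV (3.3): `(1−γ)U + DU·W + ∇P = 0`, `W y = γy + U y`, centre `0`), EXACT, class-free,
`γ`-free identities for derivatives ALONG `W` (a derivative along `W` is minus the backward-orbit derivative):

* (L1) **`fderiv_inflowRatio_transport`** — for a fixed vector `e`, on `{⟪y,e⟫ ≠ 0}` the inflow ratio `L_e = −⟪U,e⟫/⟪y,e⟫` obeys
  `(W·∇)L_e = −L_e(1 − L_e) + ⟪∇P,e⟫/⟪y,e⟫` — R43's height/momentum ledgers have characteristic roots `−γ, 1−γ` differing by ONE, so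
  their ratio obeys the pure logistic law with the pressure as the only source;
* (L1′) **`inner_gradient_pressure_eq_sheath`** — the same solved for `⟪∇P, e⟫` (the SHEATH IDENTITY);
* (L2) **`fderiv_radialRatio_transport`** — the radial ratio `λ = −⟪U y, y⟫/‖y‖²` obeys `(W·∇)λ = −λ(1−λ) − τ² + π` with the tangential
  source `τ² = (‖U‖²‖y‖² − ⟪U,y⟫²)/‖y‖⁴` and `π = ⟪∇P, y⟫/‖y‖²` (the law of motion behind every radial-rate binder of v81);
* `logisticLawDirectional`, `sheathIdentity`, `logisticLawRadial` — the Sketch44 texts.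

Tools: `inner_fderiv_velocity_transport` (`⟪DU(y)W(y), e⟫ = −(1−γ)⟪U y,e⟫ − ⟪∇P y,e⟫`), `inner_selfSimilarTransport_left`.
HONEST FRAMING: calculus identities for HYPOTHETICAL self-similar Euler profiles (MODEL lattice of the crux class); nothing here proves the
crux E (19832 OPEN), any door Target, or Navier–Stokes regularity. [cite: ConstantinIgnatovaVicol2026Putative, §3.1.1 eq. (3.3), §3.4 eq. (3.19)]
-/

noncomputable section

open Set Filter Topology Metric Function InnerProductSpace
open scoped RealInnerProductSpace

set_option linter.dupNamespace false

namespace Summit.NavierStokesRegularity.NavierStokesRegularity.Theorems.PowerGaugeEulerLiouville.Logistic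

open Literature.Analysis Literature.Analysis.FluidPDE
open Summit.NavierStokesRegularity.NavierStokesRegularity.Theorems.PowerGaugeEulerLiouville

variable {γ : ℝ} {U : EuclideanSpace ℝ (Fin 3) → EuclideanSpace ℝ (Fin 3)} {P : EuclideanSpace ℝ (Fin 3) → ℝ}

/-! ### Tools -/

/-- The profile equation tested against a fixed vector: `⟪DU(y)[W y], e⟫ = −(1−γ)⟪U y, e⟫ − ⟪∇P y, e⟫`.
[cite: ConstantinIgnatovaVicol2026Putative, §3.1.1 eq. (3.3)] -/
theorem inner_fderiv_velocity_transport (hprof : IsSelfSimilarEulerProfile γ 0 U P) (y e : EuclideanSpace ℝ (Fin 3)) :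
    ⟪fderiv ℝ U y (selfSimilarTransport γ 0 U y), e⟫ = -(1 - γ) * ⟪U y, e⟫ - ⟪gradient P y, e⟫ := by
  have h := hprof.profile_eq_transport y
  have e1 : fderiv ℝ U y (selfSimilarTransport γ 0 U y) = -((1 - γ) • U y) - gradient P y := by
    linear_combination (norm := module) h
  rw [e1, inner_sub_left, inner_neg_left, real_inner_smul_left]
  ring

/-- `⟪W y, e⟫ = γ⟪y, e⟫ + ⟪U y, e⟫`. [cite: ConstantinIgnatovaVicol2026Putative, §3.4 eq. (3.19)] -/
theorem inner_selfSimilarTransport_left (γ : ℝ) (U : EuclideanSpace ℝ (Fin 3) → EuclideanSpace ℝ (Fin 3))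
    (y e : EuclideanSpace ℝ (Fin 3)) :
    ⟪selfSimilarTransport γ 0 U y, e⟫ = γ * ⟪y, e⟫ + ⟪U y, e⟫ := by
  rw [selfSimilarTransport_apply, sub_zero, inner_add_left, real_inner_smul_left]

/-- `x ↦ ⟪U x, e⟫` has derivative `h ↦ ⟪DU(y) h, e⟫`. [folklore] -/
theorem hasFDerivAt_inner_velocity_const (hprof : IsSelfSimilarEulerProfile γ 0 U P) (y e : EuclideanSpace ℝ (Fin 3)) :
    HasFDerivAt (fun x : EuclideanSpace ℝ (Fin 3) => ⟪U x, e⟫) ((innerSL ℝ e).comp (fderiv ℝ U y)) y := by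
  have hfun : (fun x : EuclideanSpace ℝ (Fin 3) => ⟪U x, e⟫) = fun x => innerSL ℝ e (U x) := by
    funext x; rw [innerSL_apply_apply, real_inner_comm]
  rw [hfun]
  exact (innerSL ℝ e).hasFDerivAt.comp y (hprof.differentiable_velocity y).hasFDerivAt

/-- `x ↦ ⟪x, e⟫` has derivative `h ↦ ⟪h, e⟫ = innerSL e`. [folklore] -/
theorem hasFDerivAt_inner_id_const (y e : EuclideanSpace ℝ (Fin 3)) :
    HasFDerivAt (fun x : EuclideanSpace ℝ (Fin 3) => ⟪x, e⟫) (innerSL ℝ e) y := by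
  have hfun : (fun x : EuclideanSpace ℝ (Fin 3) => ⟪x, e⟫) = fun x => innerSL ℝ e x := by
    funext x; rw [innerSL_apply_apply, real_inner_comm]
  rw [hfun]
  exact (innerSL ℝ e).hasFDerivAt

/-! ### (L1) The directional logistic law and (L1′) the sheath identity -/

/-- **(L1) DIRECTIONAL LOGISTIC LAW.**  On `{⟪y,e⟫ ≠ 0}`: `(W·∇)L_e (y) = −L_e(y)(1 − L_e(y)) + ⟪∇P y, e⟫/⟪y, e⟫`,
`L_e(x) = −⟪U x, e⟫/⟪x, e⟫`. [cite: ConstantinIgnatovaVicol2026Putative, §3.1.1 eq. (3.3)] -/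
theorem fderiv_inflowRatio_transport (hprof : IsSelfSimilarEulerProfile γ 0 U P) (e : EuclideanSpace ℝ (Fin 3))
    {y : EuclideanSpace ℝ (Fin 3)} (hye : ⟪y, e⟫ ≠ 0) :
    fderiv ℝ (fun x : EuclideanSpace ℝ (Fin 3) => -⟪U x, e⟫ / ⟪x, e⟫) y (selfSimilarTransport γ 0 U y) =
      -((-⟪U y, e⟫ / ⟪y, e⟫) * (1 - (-⟪U y, e⟫ / ⟪y, e⟫))) + ⟪gradient P y, e⟫ / ⟪y, e⟫ := by
  have ha := (hasFDerivAt_inner_velocity_const hprof y e).neg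
  have hb := hasFDerivAt_inner_id_const y e
  have hbinv : HasFDerivAt (fun x : EuclideanSpace ℝ (Fin 3) => (⟪x, e⟫)⁻¹) ((-(⟪y, e⟫ ^ 2)⁻¹) • innerSL ℝ e) y :=
    (hasDerivAt_inv hye).comp_hasFDerivAt y hb
  have hf : HasFDerivAt (fun x : EuclideanSpace ℝ (Fin 3) => -⟪U x, e⟫ / ⟪x, e⟫)
      ((-⟪U y, e⟫) • ((-(⟪y, e⟫ ^ 2)⁻¹) • innerSL ℝ e) + (⟪y, e⟫)⁻¹ • -((innerSL ℝ e).comp (fderiv ℝ U y))) y := by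
    have h := ha.mul hbinv
    refine h.congr_of_eventuallyEq (Filter.Eventually.of_forall fun x => ?_)
    simp only [Pi.mul_apply, Pi.neg_apply, div_eq_mul_inv]
  rw [hf.fderiv]
  simp only [_root_.add_apply, FunLike.coe_smul, Pi.smul_apply, _root_.neg_apply,
    ContinuousLinearMap.comp_apply, innerSL_apply_apply, smul_eq_mul]
  rw [real_inner_comm (fderiv ℝ U y (selfSimilarTransport γ 0 U y)) e, inner_fderiv_velocity_transport hprof y e,
    real_inner_comm (selfSimilarTransport γ 0 U y) e, inner_selfSimilarTransport_left]
  field_simp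
  ring

/-- **(L1′) SHEATH IDENTITY**: `⟪∇P y, e⟫ = ⟪y,e⟫·((W·∇)L_e (y) + L_e(y)(1 − L_e(y)))` on `{⟪y,e⟫ ≠ 0}` — the axial pressure
gradient of a jet is read off the inflow-ratio field alone. [cite: ConstantinIgnatovaVicol2026Putative, §3.1.1 eq. (3.3)] -/
theorem inner_gradient_pressure_eq_sheath (hprof : IsSelfSimilarEulerProfile γ 0 U P) (e : EuclideanSpace ℝ (Fin 3))
    {y : EuclideanSpace ℝ (Fin 3)} (hye : ⟪y, e⟫ ≠ 0) :
    ⟪gradient P y, e⟫ =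
      ⟪y, e⟫ * (fderiv ℝ (fun x : EuclideanSpace ℝ (Fin 3) => -⟪U x, e⟫ / ⟪x, e⟫) y (selfSimilarTransport γ 0 U y) +
        (-⟪U y, e⟫ / ⟪y, e⟫) * (1 - (-⟪U y, e⟫ / ⟪y, e⟫))) := by
  rw [fderiv_inflowRatio_transport hprof e hye]
  field_simp
  ring

/-! ### (L2) The radial logistic law with tangential source -/

/-- **(L2) RADIAL LOGISTIC LAW WITH TANGENTIAL SOURCE.**  For `y ≠ 0`, with `λ = −⟪U y, y⟫/‖y‖²`,
`τ² = (‖U y‖²‖y‖² − ⟪U y, y⟫²)/‖y‖⁴`, `π = ⟪∇P y, y⟫/‖y‖²`: `(W·∇)λ = −λ(1−λ) − τ² + π`.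
[cite: ConstantinIgnatovaVicol2026Putative, §3.1.1 eq. (3.3)] -/
theorem fderiv_radialRatio_transport (hprof : IsSelfSimilarEulerProfile γ 0 U P) {y : EuclideanSpace ℝ (Fin 3)} (hy : y ≠ 0) :
    fderiv ℝ (fun x : EuclideanSpace ℝ (Fin 3) => -⟪U x, x⟫ / ‖x‖ ^ 2) y (selfSimilarTransport γ 0 U y) =
      -((-⟪U y, y⟫ / ‖y‖ ^ 2) * (1 - (-⟪U y, y⟫ / ‖y‖ ^ 2)))
        - (‖U y‖ ^ 2 * ‖y‖ ^ 2 - ⟪U y, y⟫ ^ 2) / ‖y‖ ^ 4 + ⟪gradient P y, y⟫ / ‖y‖ ^ 2 := by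
  have hy2 : ‖y‖ ^ 2 ≠ 0 := pow_ne_zero 2 (norm_ne_zero_iff.2 hy)
  have hU : HasFDerivAt U (fderiv ℝ U y) y := (hprof.differentiable_velocity y).hasFDerivAt
  -- `a x = ⟪U x, x⟫`
  have ha : HasFDerivAt (fun x : EuclideanSpace ℝ (Fin 3) => ⟪U x, x⟫)
      ((fderivInnerCLM ℝ (U y, y)).comp ((fderiv ℝ U y).prod (ContinuousLinearMap.id ℝ _))) y :=
    hU.inner ℝ (hasFDerivAt_id y)
  -- `b x = ‖x‖²`
  have hb : HasFDerivAt (fun x : EuclideanSpace ℝ (Fin 3) => ‖x‖ ^ 2) (2 • innerSL ℝ y) y :=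
    (hasStrictFDerivAt_norm_sq y).hasFDerivAt
  have hbinv : HasFDerivAt (fun x : EuclideanSpace ℝ (Fin 3) => (‖x‖ ^ 2)⁻¹) ((-((‖y‖ ^ 2) ^ 2)⁻¹) • (2 • innerSL ℝ y)) y :=
    (hasDerivAt_inv hy2).comp_hasFDerivAt y hb
  have hf : HasFDerivAt (fun x : EuclideanSpace ℝ (Fin 3) => -⟪U x, x⟫ / ‖x‖ ^ 2)
      ((-⟪U y, y⟫) • ((-((‖y‖ ^ 2) ^ 2)⁻¹) • (2 • innerSL ℝ y)) +
        (‖y‖ ^ 2)⁻¹ • -((fderivInnerCLM ℝ (U y, y)).comp ((fderiv ℝ U y).prod (ContinuousLinearMap.id ℝ _)))) y := by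
    have h := ha.neg.mul hbinv
    refine h.congr_of_eventuallyEq (Filter.Eventually.of_forall fun x => ?_)
    simp only [Pi.mul_apply, Pi.neg_apply, div_eq_mul_inv]
  rw [hf.fderiv]
  simp only [_root_.add_apply, FunLike.coe_smul, Pi.smul_apply, _root_.neg_apply,
    ContinuousLinearMap.comp_apply, ContinuousLinearMap.prod_apply, ContinuousLinearMap.id_apply, fderivInnerCLM_apply,
    innerSL_apply_apply, smul_eq_mul]
  rw [inner_fderiv_velocity_transport hprof y y, real_inner_comm (selfSimilarTransport γ 0 U y) (U y),
    real_inner_comm (selfSimilarTransport γ 0 U y) y, inner_selfSimilarTransport_left, inner_selfSimilarTransport_left,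
    real_inner_self_eq_norm_sq, real_inner_self_eq_norm_sq, real_inner_comm (U y) y]
  have hy4 : ‖y‖ ^ 4 = (‖y‖ ^ 2) ^ 2 := by ring
  rw [hy4]
  field_simp
  ring

/-! ### The Sketch44 texts, binder-for-binder -/

/-- **`NsregP2.R44.LogisticLawDirectional`** (Sketch44 of nsreg-p2 g34, plate t46-L; `E3` spelled out).
[cite: ConstantinIgnatovaVicol2026Putative, §3.1.1 eq. (3.3)] -/
theorem logisticLawDirectional :
    ∀ (γ : ℝ) (U : EuclideanSpace ℝ (Fin 3) → EuclideanSpace ℝ (Fin 3)) (P : EuclideanSpace ℝ (Fin 3) → ℝ),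
      IsSelfSimilarEulerProfile γ 0 U P →
      ∀ (e y : EuclideanSpace ℝ (Fin 3)), ⟪y, e⟫ ≠ 0 →
        fderiv ℝ (fun x : EuclideanSpace ℝ (Fin 3) => -⟪U x, e⟫ / ⟪x, e⟫) y (selfSimilarTransport γ 0 U y) =
          -((-⟪U y, e⟫ / ⟪y, e⟫) * (1 - (-⟪U y, e⟫ / ⟪y, e⟫))) + ⟪gradient P y, e⟫ / ⟪y, e⟫ :=
  fun _ _ _ hprof e _ hye => fderiv_inflowRatio_transport hprof e hye

/-- **`NsregP2.R44.SheathIdentity`** (Sketch44, plate t46-L; `E3` spelled out). [cite: ConstantinIgnatovaVicol2026Putative, §3.1.1 eq. (3.3)] -/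
theorem sheathIdentity :
    ∀ (γ : ℝ) (U : EuclideanSpace ℝ (Fin 3) → EuclideanSpace ℝ (Fin 3)) (P : EuclideanSpace ℝ (Fin 3) → ℝ),
      IsSelfSimilarEulerProfile γ 0 U P →
      ∀ (e y : EuclideanSpace ℝ (Fin 3)), ⟪y, e⟫ ≠ 0 →
        ⟪gradient P y, e⟫ =
          ⟪y, e⟫ * (fderiv ℝ (fun x : EuclideanSpace ℝ (Fin 3) => -⟪U x, e⟫ / ⟪x, e⟫) y (selfSimilarTransport γ 0 U y) +
            (-⟪U y, e⟫ / ⟪y, e⟫) * (1 - (-⟪U y, e⟫ / ⟪y, e⟫))) :=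
  fun _ _ _ hprof e _ hye => inner_gradient_pressure_eq_sheath hprof e hye

/-- **`NsregP2.R44.LogisticLawRadial`** (Sketch44, plate t46-L; `E3` spelled out). [cite: ConstantinIgnatovaVicol2026Putative, §3.1.1 eq. (3.3)] -/
theorem logisticLawRadial :
    ∀ (γ : ℝ) (U : EuclideanSpace ℝ (Fin 3) → EuclideanSpace ℝ (Fin 3)) (P : EuclideanSpace ℝ (Fin 3) → ℝ),
      IsSelfSimilarEulerProfile γ 0 U P →
      ∀ y : EuclideanSpace ℝ (Fin 3), y ≠ 0 →
        fderiv ℝ (fun x : EuclideanSpace ℝ (Fin 3) => -⟪U x, x⟫ / ‖x‖ ^ 2) y (selfSimilarTransport γ 0 U y) =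
          -((-⟪U y, y⟫ / ‖y‖ ^ 2) * (1 - (-⟪U y, y⟫ / ‖y‖ ^ 2)))
            - (‖U y‖ ^ 2 * ‖y‖ ^ 2 - ⟪U y, y⟫ ^ 2) / ‖y‖ ^ 4 + ⟪gradient P y, y⟫ / ‖y‖ ^ 2 :=
  fun _ _ _ hprof _ hy => fderiv_radialRatio_transport hprof hy

/-! ### Appendix (same seat): the ballistic plateau (SEEDS-R45 (R45-4), exact) -/

/-- **NO AXIAL PRESSURE GRADIENT ON A BALLISTIC PLATEAU** (SEEDS-R45 (R45-4), exact, class-free).  At a point where the velocity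
is ballistic in the direction `e` to first order — `⟪U y, e⟫ = −⟪y, e⟫` and `⟪DU(y)h, e⟫ = −⟪h, e⟫` for all `h` (e.g. on an open set
where `⟪U, e⟫ = −⟪·, e⟫`, i.e. `L_e ≡ 1`) — the profile equation tested against `e` gives `⟪∇P y, e⟫ = 0`:
`(1−γ)⟪U,e⟫ + ⟪DU·W, e⟫ + ⟪∇P, e⟫ = −(1−γ)⟪y,e⟫ − ⟪W,e⟫ + ⟪∇P,e⟫` and `⟪W,e⟫ = γ⟪y,e⟫ + ⟪U,e⟫ = (γ−1)⟪y,e⟫`.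
[cite: ConstantinIgnatovaVicol2026Putative, §3.1.1 eq. (3.3)] -/
theorem inner_gradient_pressure_eq_zero_of_ballistic (hprof : IsSelfSimilarEulerProfile γ 0 U P) {e y : EuclideanSpace ℝ (Fin 3)}
    (hUe : ⟪U y, e⟫ = -⟪y, e⟫) (hDUe : ∀ h : EuclideanSpace ℝ (Fin 3), ⟪fderiv ℝ U y h, e⟫ = -⟪h, e⟫) :
    ⟪gradient P y, e⟫ = 0 := by
  have h1 := inner_fderiv_velocity_transport hprof y e
  rw [hDUe, inner_selfSimilarTransport_left, hUe] at h1
  linarith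

/-- **The plateau as an open set**: if `⟪U x, e⟫ = −⟪x, e⟫` on an open set `O`, then `⟪∇P y, e⟫ = 0` for `y ∈ O` (differentiate the
identity on `O` to get `⟪DU(y)h, e⟫ = −⟪h, e⟫`). [cite: ConstantinIgnatovaVicol2026Putative, §3.1.1 eq. (3.3)] -/
theorem inner_gradient_pressure_eq_zero_of_plateau (hprof : IsSelfSimilarEulerProfile γ 0 U P) {e : EuclideanSpace ℝ (Fin 3)}
    {O : Set (EuclideanSpace ℝ (Fin 3))} (hO : IsOpen O) (hplat : ∀ x ∈ O, ⟪U x, e⟫ = -⟪x, e⟫)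
    {y : EuclideanSpace ℝ (Fin 3)} (hy : y ∈ O) :
    ⟪gradient P y, e⟫ = 0 := by
  refine inner_gradient_pressure_eq_zero_of_ballistic hprof (hplat y hy) fun h => ?_
  -- the derivative of `x ↦ ⟪U x, e⟫` at `y` equals that of `x ↦ −⟪x, e⟫`
  have hev : (fun x : EuclideanSpace ℝ (Fin 3) => ⟪U x, e⟫) =ᶠ[𝓝 y] fun x => -⟪x, e⟫ :=
    Filter.eventually_of_mem (hO.mem_nhds hy) fun x hx => hplat x hx
  have hD1 := (hasFDerivAt_inner_velocity_const hprof y e)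
  have hD2 : HasFDerivAt (fun x : EuclideanSpace ℝ (Fin 3) => -⟪x, e⟫) (-(innerSL ℝ e)) y := (hasFDerivAt_inner_id_const y e).neg
  have huniq : (innerSL ℝ e).comp (fderiv ℝ U y) = -(innerSL ℝ e) := hD1.unique (hD2.congr_of_eventuallyEq hev)
  have hh := congrArg (fun L : EuclideanSpace ℝ (Fin 3) →L[ℝ] ℝ => L h) huniq
  simp only [ContinuousLinearMap.comp_apply, innerSL_apply_apply, _root_.neg_apply] at hh
  rw [real_inner_comm] at hh
  rw [hh, real_inner_comm]

end Summit.NavierStokesRegularity.NavierStokesRegularity.Theorems.PowerGaugeEulerLiouville.Logistic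

end
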